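import Mathlib
import Literature.Geometry.Symplectic.JHolomorphicMap

/-!
# Vocabulary of the anchored-pencil continuity method (crux `TameOrBrodyR4`, stmt-SmoothPoincare4-7826, line `Sketch`)

Route `SullivanDual`, crux `Summit.SmoothPoincare4.SmoothPoincare4.Theses.SullivanDual.TameOrBrodyR4`
(every `C^∞` almost complex structure `J` on `ℝ⁴` standard on `‖x‖ ≥ R` is tamed by a closed 2-form
standard at infinity OR carries a bounded entire `J`-curve). The line `Sketch` (idea
`anchored-pencils`) reduces the crux, sorry-free in the tree (`…TameOrBrodyR4Reduction.lean`,
`Reduction.anchorsOrBlowup_of`), to Gromov's two complete pencils of `J`-planes anchored at the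
standard end (evaluation maps) OR gradient blow-up. This file fixes the VOCABULARY in which that
research core is cut into its deep inputs and its classical continuity-method layer (skeleton v8 of
`Cruxes/TameOrBrodyR4/Lines/Sketch.lean`); it contains definitions only (objects the line posits),
no claims.

* `IsCoordFrame P Q eP eQ` — a unitary splitting of `ℝ⁴` into two complex coordinates
  `P, Q : ℝ⁴ →L[ℝ] ℂ` (`‖x‖² = |P x|² + |Q x|²`) with sections `eP, eQ : ℂ →L[ℝ] ℝ⁴`
  (`(P, Q) = (z, w)` for the `A`-pencil, `(w, z)` for the `B`-pencil — every statement below is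
  generic in the frame, so it is used twice and no coordinate swap is ever needed).
* `IsPencilMember J R P Q b u` — `u : ℂ → ℝ⁴` is a NORMALISED MEMBER of the pencil in direction
  `P` with asymptotic value `b`: `C^∞`, flat-`J`-holomorphic, injective, immersed, `Q ∘ u → b` at
  infinity, normalised by `P (u ξ) - ξ → 0` (this fixes the affine reparametrisation freedom of a
  `J`-holomorphic parametrisation of the plane and makes `u` proper), crossing every far line
  `{P = c}`, `|c| > 2R`, at exactly one parameter, transversally. For `|b| ≥ 2R` the flat plane
  `ξ ↦ eP ξ + eQ b` is such a member. (Gromov 1985 §2.4.A: the `A`-spheres of `S² × S²` through the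
  points of the sphere at infinity, read in `ℝ⁴ = S² × S² ∖ (S² ∨ S²)`.)
* `HasLocalFamilies J R P Q` — DEEP INPUT 1 (automatic transversality with the point constraint at
  infinity + implicit function theorem + nowhere-vanishing normal variation;
  Hofer–Lizan–Sikorav 1997 Thm 1, Wendl 2018 Thm 2.44–2.46, McDuff–Salamon 2012 Thm 3.1.5 / §3.3):
  through every member passes a jointly `C^∞` local family of members parametrised by the
  asymptotic value, whose parameter derivative is nowhere tangent to the member.
* `HasUniqueDisjointMembers J R P Q`, `HasEmbeddedLimits J R P Q`, `HasTransverseMembers J R P Q` —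
  DEEP INPUT 2 (positivity of
  intersections and the adjunction inequality for `J`-curves in dimension four; McDuff 1991,
  Micallef–White 1995, McDuff–Salamon 2012 Thm 2.6.3–2.6.4 and App. E; homologically `A·A = 0`,
  `A·B = 1` in `S² × S²`): members with the same asymptotic value coincide and members with
  different values are disjoint; a `C¹_loc`-limit of members having every member property except
  embeddedness is embedded; an `A`-member and a `B`-member meet transversally.

Everything else of the research core (normalisation and confinement of members by the growth
theorem for univalent functions at infinity and the maximum principle, closedness modulo blow-up,
the clopen argument, the global evaluation map with its smoothness, bijectivity, bijective
differential, honesty and asymptotics) is classical and is proved over these inputs in the line's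
Theorems files.

Non-vacuity certificate (last section, registered helper `helper_memberFlat` of the crux item): for
`|b| ≥ 2R` the honest far plane `ξ ↦ eP ξ + eQ b` IS a member (`IsPencilMember J R P Q b _`), with the
small frame algebra `PencilDefs.norm_P_le`, `norm_Q_le`, `eq_of_apply_eq`, `IsCoordFrame.symm`.

References: M. Gromov, *Pseudo holomorphic curves in symplectic manifolds*, Invent. Math. 82 (1985),
§2.4.A; H. Hofer, V. Lizan, J.-C. Sikorav, *On genericity for holomorphic curves in
four-dimensional almost-complex manifolds*, J. Geom. Anal. 7 (1997), Thm 1; C. Wendl, *Holomorphic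
Curves in Low Dimensions*, LNM 2216 (2018), Thm 2.44–2.46, Thm 6.8; D. McDuff, *The local behaviour
of holomorphic curves in almost complex 4-manifolds*, J. Diff. Geom. 34 (1991); M. Micallef,
B. White, Ann. of Math. 141 (1995); D. McDuff, D. Salamon, *J-holomorphic curves and symplectic
topology*, 2nd ed. (2012), Thm 2.6.3, Thm 2.6.4, Thm 3.1.5, App. E.
-/

-- the registered namespace `Summit.SmoothPoincare4.SmoothPoincare4.…` repeats a component
set_option linter.dupNamespace false

noncomputable section

open scoped ContDiff Topology
open Filter Set Literature.Geometry.Symplectic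

namespace Summit.SmoothPoincare4.SmoothPoincare4.Cruxes.TameOrBrodyR4.Sketch

/-- Local notation for the model space `ℝ⁴ = EuclideanSpace ℝ (Fin 4)`. -/
local notation "E4" => EuclideanSpace ℝ (Fin 4)

/-- **Coordinate frame.** `P, Q : ℝ⁴ →L[ℝ] ℂ` split `ℝ⁴` unitarily (`‖x‖² = |P x|² + |Q x|²`) and
`eP, eQ : ℂ →L[ℝ] ℝ⁴` are the corresponding sections: `P ∘ eP = id`, `Q ∘ eP = 0`, `P ∘ eQ = 0`,
`Q ∘ eQ = id`, `eP ∘ P + eQ ∘ Q = id`. Instances: `(z, w)` and `(w, z)` on `ℝ⁴ = ℂ_z × ℂ_w`. -/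
def IsCoordFrame (P Q : E4 →L[ℝ] ℂ) (eP eQ : ℂ →L[ℝ] E4) : Prop :=
  (∀ x : E4, ‖x‖ ^ 2 = ‖P x‖ ^ 2 + ‖Q x‖ ^ 2) ∧
    (∀ ξ : ℂ, P (eP ξ) = ξ) ∧ (∀ ξ : ℂ, Q (eP ξ) = 0) ∧
    (∀ b : ℂ, P (eQ b) = 0) ∧ (∀ b : ℂ, Q (eQ b) = b) ∧
    (∀ x : E4, eP (P x) + eQ (Q x) = x)

/-- **Normalised member of the pencil in direction `P` with asymptotic value `b`** (for a `J`
standard on `‖x‖ ≥ R`; the far structure is required on `|c| > 2R`, strictly, so that it survives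
`C¹_loc`-limits): `u : ℂ → ℝ⁴` is `C^∞`, flat-`J`-holomorphic, injective and immersed (an embedded
`J`-plane), `Q (u ξ) → b` at infinity, NORMALISED by `P (u ξ) - ξ → 0` at infinity (a
`J`-holomorphic parametrisation of a plane is unique up to an affine map of `ℂ`; this clause fixes
it and forces properness), and `u` crosses every far line `{P = c}`, `|c| > 2R`, at exactly one
parameter, with `ξ ↦ P (u ξ)` a local diffeomorphism wherever `|P (u ξ)| > 2R` (Gromov 1985 §2.4.A:
the `A`-planes of `S² × S² ∖ (S² ∨ S²)` through one point of the sphere at infinity). -/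
def IsPencilMember (J : E4 → E4 →L[ℝ] E4) (R : ℝ) (P Q : E4 →L[ℝ] ℂ) (b : ℂ) (u : ℂ → E4) :
    Prop :=
  ContDiff ℝ ∞ u ∧ IsJHolomorphicFlat J u ∧ Function.Injective u ∧
    (∀ ξ : ℂ, Function.Injective (fderiv ℝ u ξ)) ∧
    Tendsto (fun ξ => Q (u ξ)) (cocompact ℂ) (𝓝 b) ∧
    Tendsto (fun ξ => P (u ξ) - ξ) (cocompact ℂ) (𝓝 0) ∧
    (∀ c : ℂ, 2 * R < ‖c‖ → ∃! ξ, P (u ξ) = c) ∧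
    (∀ ξ : ℂ, 2 * R < ‖P (u ξ)‖ → Function.Bijective (fderiv ℝ (fun ξ => P (u ξ)) ξ))

/-- **Deep input 1: the local family through a member (automatic transversality with the point
constraint at infinity)**, as a property of `J` (standard on `‖x‖ ≥ R`) and the frame `(P, Q)`:
through every member `u₀` with asymptotic value `b₀` there are `ε > 0` and a family
`Φ : ℂ → ℂ → ℝ⁴`, jointly `C^∞` on `ball b₀ ε × ℂ`, with `Φ b₀ = u₀`, every `Φ b` (`|b - b₀| < ε`) a
member with asymptotic value `b`, and the parameter derivative nowhere tangent to the member: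
`∂_b Φ(b, ξ) β ∈ range ∂_ξ Φ(b, ξ)` only for `β = 0` (the normal variation of the family solves the
normal linearised Cauchy–Riemann equation on a degree-zero normal bundle and is non-zero at
infinity, so it has no zeros). Sources: Hofer–Lizan–Sikorav 1997 Thm 1 and Wendl 2018
Thm 2.44–2.46 (immersed index-2 spheres with `c₁(N) = 0 ≥ -1` are Fredholm regular for every `J`;
kernel elements have only positive zeros, `c₁(N) = 0` in number); McDuff–Salamon 2012 Thm 3.1.5 and
§3.3 (implicit function theorem, smooth universal family, elliptic bootstrapping); applied to the
`A`-spheres of `(S² × S², J ∪ J₀)` through the points `(∞, b)` of the sphere at infinity. -/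
def HasLocalFamilies (J : E4 → E4 →L[ℝ] E4) (R : ℝ) (P Q : E4 →L[ℝ] ℂ) : Prop :=
  ∀ (b₀ : ℂ) (u₀ : ℂ → E4), IsPencilMember J R P Q b₀ u₀ →
    ∃ ε > 0, ∃ Φ : ℂ → ℂ → E4,
      ContDiffOn ℝ ∞ (fun p : ℂ × ℂ => Φ p.1 p.2) (Metric.ball b₀ ε ×ˢ univ) ∧ Φ b₀ = u₀ ∧
      (∀ b ∈ Metric.ball b₀ ε, IsPencilMember J R P Q b (Φ b)) ∧
      (∀ b ∈ Metric.ball b₀ ε, ∀ ξ β ζ : ℂ,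
        fderiv ℝ (fun b' => Φ b' ξ) b β = fderiv ℝ (Φ b) ξ ζ → β = 0)

/-- **Deep input 2a: uniqueness and disjointness of members (positivity of intersections,
`A·A = 0`)**, as a property of `J` and the frame: two members with the same asymptotic value are
equal (as normalised maps); two members with different asymptotic values have disjoint images.
Sources: McDuff 1991 and Micallef–White 1995 (isolated intersections of distinct `J`-curves in
dimension four are positive), McDuff–Salamon 2012 Thm 2.6.3 and App. E; in `S² × S²` two distinct
`A`-spheres have intersection number `0`, and two `A`-spheres through the same point at infinity
would meet there positively; unique continuation for `J`-curves. -/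
def HasUniqueDisjointMembers (J : E4 → E4 →L[ℝ] E4) (R : ℝ) (P Q : E4 →L[ℝ] ℂ) : Prop :=
  ∀ (b b' : ℂ) (u u' : ℂ → E4), IsPencilMember J R P Q b u → IsPencilMember J R P Q b' u' →
    (b = b' → u = u') ∧ (b ≠ b' → ∀ ξ ξ' : ℂ, u ξ ≠ u' ξ')

/-- **Deep input 2b: limits of members are embedded (adjunction)**, as a property of `J` and the
frame: if members `u n` (asymptotic values `b n → b⋆`) converge locally uniformly on `ℂ` together
with their first derivatives to a `C^∞` flat-`J`-holomorphic `v` which already has every member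
property except embeddedness (`Q ∘ v → b⋆`, normalised, far lines crossed once transversally),
then `v` is injective and immersed. Sources: the adjunction inequality for simple `J`-spheres in
almost complex 4-manifolds (McDuff 1991; Micallef–White 1995 Thm 7.1; McDuff–Salamon 2012 Thm 2.6.4
and App. E): a simple `A`-sphere in `S² × S²` has `δ = (A·A - c₁(A) + 2)/2 = 0` double points, hence
is embedded; `v` is simple because it is injective near infinity. -/
def HasEmbeddedLimits (J : E4 → E4 →L[ℝ] E4) (R : ℝ) (P Q : E4 →L[ℝ] ℂ) : Prop :=
  ∀ (b : ℕ → ℂ) (u : ℕ → ℂ → E4) (bs : ℂ) (v : ℂ → E4),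
    (∀ n, IsPencilMember J R P Q (b n) (u n)) → Tendsto b atTop (𝓝 bs) →
    ContDiff ℝ ∞ v → IsJHolomorphicFlat J v →
    TendstoLocallyUniformly u v atTop →
    TendstoLocallyUniformly (fun n => fderiv ℝ (u n)) (fderiv ℝ v) atTop →
    Tendsto (fun ξ => Q (v ξ)) (cocompact ℂ) (𝓝 bs) →
    Tendsto (fun ξ => P (v ξ) - ξ) (cocompact ℂ) (𝓝 0) →
    (∀ c : ℂ, 2 * R < ‖c‖ → ∃! ξ, P (v ξ) = c) →
    (∀ ξ : ℂ, 2 * R < ‖P (v ξ)‖ → Function.Bijective (fderiv ℝ (fun ξ => P (v ξ)) ξ)) →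
    Function.Injective v ∧ ∀ ξ : ℂ, Function.Injective (fderiv ℝ v ξ)

/-- **Deep input 2c: an `A`-member and a `B`-member meet transversally (positivity of
intersections, `A·B = 1`)**, as a property of `J` and the frame: if a member `u` of the pencil in
direction `P` and a member `w` of the pencil in direction `Q` (the frame reversed) pass through the
same point, their tangent planes there meet only in `0`. Sources: McDuff–Salamon 2012 Thm 2.6.3 and
App. E (a tangential isolated intersection of two `J`-curves contributes at least `2` to the
intersection number); in `S² × S²`, `A·B = 1`. -/
def HasTransverseMembers (J : E4 → E4 →L[ℝ] E4) (R : ℝ) (P Q : E4 →L[ℝ] ℂ) : Prop :=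
  ∀ (b c : ℂ) (u w : ℂ → E4), IsPencilMember J R P Q b u → IsPencilMember J R Q P c w →
    ∀ ξ η : ℂ, u ξ = w η → ∀ ζ ζ' : ℂ, fderiv ℝ u ξ ζ = fderiv ℝ w η ζ' → ζ = 0

/-! ### Non-vacuity: the honest far planes are members -/

namespace PencilDefs

/-- In a coordinate frame, `|Q x| ≤ ‖x‖`. -/
theorem norm_Q_le {P Q : E4 →L[ℝ] ℂ} {eP eQ : ℂ →L[ℝ] E4} (h : IsCoordFrame P Q eP eQ) (x : E4) :
    ‖Q x‖ ≤ ‖x‖ :=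
  le_of_pow_le_pow_left₀ two_ne_zero (norm_nonneg x) (by rw [h.1 x]; nlinarith [sq_nonneg ‖P x‖])

/-- In a coordinate frame, `|P x| ≤ ‖x‖`. -/
theorem norm_P_le {P Q : E4 →L[ℝ] ℂ} {eP eQ : ℂ →L[ℝ] E4} (h : IsCoordFrame P Q eP eQ) (x : E4) :
    ‖P x‖ ≤ ‖x‖ :=
  le_of_pow_le_pow_left₀ two_ne_zero (norm_nonneg x) (by rw [h.1 x]; nlinarith [sq_nonneg ‖Q x‖])

/-- In a coordinate frame, a vector is determined by its two coordinates. -/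
theorem eq_of_apply_eq {P Q : E4 →L[ℝ] ℂ} {eP eQ : ℂ →L[ℝ] E4} (h : IsCoordFrame P Q eP eQ)
    {x y : E4} (hP : P x = P y) (hQ : Q x = Q y) : x = y := by
  have h0 : ‖x - y‖ ^ 2 = 0 := by
    rw [h.1 (x - y), map_sub, map_sub, hP, hQ, sub_self, sub_self, norm_zero]; ring
  exact sub_eq_zero.mp (norm_eq_zero.mp (pow_eq_zero_iff two_ne_zero |>.mp h0))

/-- The reversed frame `(Q, P)` is a coordinate frame. -/
theorem IsCoordFrame.symm {P Q : E4 →L[ℝ] ℂ} {eP eQ : ℂ →L[ℝ] E4} (h : IsCoordFrame P Q eP eQ) :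
    IsCoordFrame Q P eQ eP :=
  ⟨fun x => by rw [h.1 x, add_comm], h.2.2.2.2.1, h.2.2.2.1, h.2.2.1, h.2.1,
    fun x => by rw [add_comm, h.2.2.2.2.2 x]⟩

end PencilDefs

/-- **Registered helper `helper_memberFlat` (non-vacuity of the vocabulary): the honest far planes
are members.** For `|b| ≥ 2R` the flat plane `ξ ↦ eP ξ + eQ b` (i.e. `{Q = b}` in its linear
parametrisation) is a normalised member with asymptotic value `b`: it lies in `‖x‖ ≥ |b| ≥ 2R ≥ R`
where `J` is `i` in the frame, so it is `J`-holomorphic; `P ∘ u = id`, `Q ∘ u = b`. -/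
theorem helper_memberFlat (J : E4 → E4 →L[ℝ] E4) (R : ℝ) (P Q : E4 →L[ℝ] ℂ) (eP eQ : ℂ →L[ℝ] E4)
    (hR : 0 < R) (hPQ : IsCoordFrame P Q eP eQ)
    (hJP : ∀ x : E4, R ≤ ‖x‖ → ∀ v, P (J x v) = Complex.I * P v)
    (hJQ : ∀ x : E4, R ≤ ‖x‖ → ∀ v, Q (J x v) = Complex.I * Q v) (b : ℂ) (hb : 2 * R ≤ ‖b‖) :
    IsPencilMember J R P Q b (fun ξ => eP ξ + eQ b) := by
  obtain ⟨-, hPeP, hQeP, hPeQ, hQeQ, -⟩ := id hPQ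
  have hPu : ∀ ξ : ℂ, P (eP ξ + eQ b) = ξ := fun ξ => by rw [map_add, hPeP, hPeQ, add_zero]
  have hQu : ∀ ξ : ℂ, Q (eP ξ + eQ b) = b := fun ξ => by rw [map_add, hQeP, hQeQ, zero_add]
  have hfar : ∀ ξ : ℂ, R ≤ ‖eP ξ + eQ b‖ := fun ξ =>
    calc R ≤ 2 * R := by linarith
      _ ≤ ‖b‖ := hb
      _ = ‖Q (eP ξ + eQ b)‖ := by rw [hQu]
      _ ≤ ‖eP ξ + eQ b‖ := PencilDefs.norm_Q_le hPQ _
  have hd : ∀ ξ : ℂ, fderiv ℝ (fun ξ => eP ξ + eQ b) ξ = eP := fun ξ =>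
    ((eP.hasFDerivAt).add_const (eQ b)).fderiv
  have hPid : (fun ξ => P (eP ξ + eQ b)) = id := funext hPu
  refine ⟨eP.contDiff.add contDiff_const, ?_, ?_, ?_, ?_, ?_, ?_, ?_⟩
  · -- flat `J`-holomorphic: compare the two coordinates
    intro z ζ
    rw [hd]
    refine PencilDefs.eq_of_apply_eq hPQ ?_ ?_
    · rw [hJP _ (hfar z), hPeP, hPeP]
    · rw [hJQ _ (hfar z), hQeP, hQeP, mul_zero]
  · intro ξ ξ' h
    have := congrArg P h
    rwa [hPu, hPu] at this
  · intro ξ ζ ζ' h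
    rw [hd] at h
    have := congrArg P h
    rwa [hPeP, hPeP] at this
  · simp only [hQu]; exact tendsto_const_nhds
  · simp only [hPu, sub_self]; exact tendsto_const_nhds
  · intro c _
    exact ⟨c, hPu c, fun ξ h => by simpa only [hPu] using h⟩
  · intro ξ _
    rw [hPid, fderiv_id]
    exact Function.bijective_id

end Summit.SmoothPoincare4.SmoothPoincare4.Cruxes.TameOrBrodyR4.Sketch
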